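import Summits.ValiantsHypothesis.ValiantsHypothesis.Theorems.GrenetZeonDualUnipotentThreeHalvesLongMassSubmodule

/-!
# `GrenetZeon.DualUnipotentThreeHalves` (stmt-ValiantsHypothesis-24318), line `slow_core`, stub (c) `SlowCore.LongMassSlowLawInv`:
# COMMUTING SUMS ARE SUB-ADDITIVE — the first SUM rule of the (c)-price (submodule currency)

In the coordinate-free currency of ✓ `longMassSlowLawInv_iff_submodule` (`…LongMassSubmodule`: a certificate of a nilpotent `V ≤ M_b(ℂ)` at
window `n` is a sub-module `W ≤ V` and an order `k` with the WINDOW property — every entry of `(A + s·w)^p`, `A ∈ V`, `w ∈ W`, `p ≤ n − 1`, has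
`s`-degree `≤ k` — of PRICE `n·k + (dim V − dim W)`), the known composition rules are: monotonicity (✓ `relCert_of_valueSpace_le`), conjugation,
transpose, and sub-additivity over LEVEL CUTS (block-triangular sums, ✓ `relCert_of_levelCut`).  A general SUM `V₁ + V₂ ≤ M_b(ℂ)` of two cheap
nilpotent spaces obeys no rule (mixed words; `V₁ + V₂` need not even be nilpotent).  This file proves the first sum rule beyond level cuts:

★★★ `window_sup_of_commute` / `price_sup_of_commute` — if `[V₁, V₂] = 0` (every element of `V₁` commutes with every element of `V₂`), then
certificates ADD: `(W₁, k₁)` for `V₁` and `(W₂, k₂)` for `V₂` give `(W₁ ⊔ W₂, k₁ + k₂)` for `V₁ ⊔ V₂`, and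
`price(V₁ ⊔ V₂) ≤ price(V₁) + price(V₂)` (`dim(V₁ ⊔ V₂) − dim(W₁ ⊔ W₂) ≤ codim_{V₁}W₁ + codim_{V₂}W₂`).  Mechanism: the binomial theorem for the
commuting polynomial matrices `A₁ + s w₁`, `A₂ + s w₂` (`Commute.add_pow'`) — `totalDegree_add_pow_apply_le_of_commute`.

EXAMPLE (not block-triangular!): KRONECKER SUMS `L ⊗ 1 + 1 ⊗ L'` of nilpotent spaces `L ≤ M_{b₁}`, `L' ≤ M_{b₂}` — IRREDUCIBLE whenever both
factors are (Burnside), of index `idx L + idx L' − 1`, the standard way to build irreducible nilpotent spaces of growing index — are priced by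
the prices of the factors.  So the (c)-content (crit-7 V34 §2) lives on nilpotent spaces that are NOT commuting sums of cheaper ones.

Honest framing.  A composition rule (`--supports stmt-ValiantsHypothesis-24318`), NOT progress on (c) itself: (c) `SlowCore.LongMassSlowLawInv`,
S3, the crux 24318, 8062 and `VP ≠ VNP` remain OPEN / NOT proved.  No sorry, no definitions, no named facts.
-/

-- single-conjunct layout: Sub = Summit, duplicated namespace component intended (the name is mandated)
set_option linter.dupNamespace false
set_option autoImplicit false

noncomputable section

namespace Summit.ValiantsHypothesis.ValiantsHypothesis.Theorems.GrenetZeon.LongMassHomogenise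

open MvPolynomial Matrix
open scoped BigOperators

variable {b : ℕ}

/-! ## §1 Degree bookkeeping for commuting polynomial matrices -/

/-- Entries of a product: degrees add. -/
theorem totalDegree_mul_apply_le {M₁ M₂ : Matrix (Fin b) (Fin b) (MvPolynomial (Fin 1) ℂ)} {k₁ k₂ : ℕ}
    (h₁ : ∀ i j, (M₁ i j).totalDegree ≤ k₁) (h₂ : ∀ i j, (M₂ i j).totalDegree ≤ k₂) (i j : Fin b) :
    ((M₁ * M₂) i j).totalDegree ≤ k₁ + k₂ := by
  rw [Matrix.mul_apply]
  refine (totalDegree_finsetSum _ _).trans (Finset.sup_le fun l _ => ?_)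
  exact (totalDegree_mul _ _).trans (Nat.add_le_add (h₁ i l) (h₂ l j))

/-- Entries of an `ℕ`-multiple: degrees do not grow. -/
theorem totalDegree_nsmul_apply_le {Q : Matrix (Fin b) (Fin b) (MvPolynomial (Fin 1) ℂ)} {k : ℕ}
    (hQ : ∀ i j, (Q i j).totalDegree ≤ k) (c : ℕ) (i j : Fin b) : ((c • Q) i j).totalDegree ≤ k := by
  rw [Matrix.smul_apply, nsmul_eq_mul]
  refine (totalDegree_mul _ _).trans ?_
  rw [← C_eq_coe_nat, totalDegree_C, zero_add]
  exact hQ i j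

/-- ★ **BINOMIAL DEGREE BOUND**: for COMMUTING polynomial matrices whose powers up to `p` have entries of degree `≤ k₁`, `≤ k₂`, the entries of
`(M₁ + M₂)^p` have degree `≤ k₁ + k₂`. -/
theorem totalDegree_add_pow_apply_le_of_commute {M₁ M₂ : Matrix (Fin b) (Fin b) (MvPolynomial (Fin 1) ℂ)} (hc : Commute M₁ M₂)
    {k₁ k₂ p : ℕ} (h₁ : ∀ a, a ≤ p → ∀ i j, ((M₁ ^ a) i j).totalDegree ≤ k₁)
    (h₂ : ∀ a, a ≤ p → ∀ i j, ((M₂ ^ a) i j).totalDegree ≤ k₂) (i j : Fin b) :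
    (((M₁ + M₂) ^ p) i j).totalDegree ≤ k₁ + k₂ := by
  rw [hc.add_pow', Matrix.sum_apply]
  refine (totalDegree_finsetSum _ _).trans (Finset.sup_le fun m hm => ?_)
  have hm' := Finset.HasAntidiagonal.mem_antidiagonal.mp hm
  refine totalDegree_nsmul_apply_le (fun i' j' => ?_) _ i j
  exact totalDegree_mul_apply_le (h₁ m.1 (by omega)) (h₂ m.2 (by omega)) i' j'

/-! ## §2 Certificates add over commuting sums -/

/-- The line matrix `A + s·w` is additive in `(A, w)`. -/
theorem lineMat_add (A₁ A₂ w₁ w₂ : Matrix (Fin b) (Fin b) ℂ) :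
    ((A₁ + A₂).map (C : ℂ → MvPolynomial (Fin 1) ℂ) + (X 0 : MvPolynomial (Fin 1) ℂ) • (w₁ + w₂).map C) =
      (A₁.map (C : ℂ → MvPolynomial (Fin 1) ℂ) + (X 0 : MvPolynomial (Fin 1) ℂ) • w₁.map C) +
        (A₂.map (C : ℂ → MvPolynomial (Fin 1) ℂ) + (X 0 : MvPolynomial (Fin 1) ℂ) • w₂.map C) := by
  ext i j : 2
  simp only [Matrix.add_apply, Matrix.map_apply, Matrix.smul_apply, map_add, smul_add]
  abel

/-- Constant matrices that commute give commuting `C`-images. -/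
theorem commute_map_C {P Q : Matrix (Fin b) (Fin b) ℂ} (h : P * Q = Q * P) :
    Commute (P.map (C : ℂ → MvPolynomial (Fin 1) ℂ)) (Q.map (C : ℂ → MvPolynomial (Fin 1) ℂ)) := by
  change P.map (C : ℂ →+* MvPolynomial (Fin 1) ℂ) * Q.map (C : ℂ →+* MvPolynomial (Fin 1) ℂ) =
    Q.map (C : ℂ →+* MvPolynomial (Fin 1) ℂ) * P.map (C : ℂ →+* MvPolynomial (Fin 1) ℂ)
  rw [← Matrix.map_mul, ← Matrix.map_mul, h]

/-- ★★★ **WINDOWS ADD OVER COMMUTING SUMS.**  If every element of `V₁` commutes with every element of `V₂`, `W₁ ≤ V₁`, `W₂ ≤ V₂`, and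
`(V₁, W₁)`, `(V₂, W₂)` have the window property at orders `k₁`, `k₂` (window `n`), then `(V₁ ⊔ V₂, W₁ ⊔ W₂)` has it at order `k₁ + k₂`. -/
theorem window_sup_of_commute (V₁ V₂ W₁ W₂ : Submodule ℂ (Matrix (Fin b) (Fin b) ℂ)) (hW₁ : W₁ ≤ V₁) (hW₂ : W₂ ≤ V₂)
    (hcomm : ∀ A₁ ∈ V₁, ∀ A₂ ∈ V₂, A₁ * A₂ = A₂ * A₁) {n k₁ k₂ : ℕ}
    (h₁ : ∀ A ∈ V₁, ∀ w ∈ W₁, ∀ p : ℕ, p ≤ n - 1 → ∀ i j : Fin b,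
      ((((A.map (C : ℂ → MvPolynomial (Fin 1) ℂ) + (X 0 : MvPolynomial (Fin 1) ℂ) • w.map C) ^ p :
        Matrix (Fin b) (Fin b) (MvPolynomial (Fin 1) ℂ)) i j).totalDegree ≤ k₁))
    (h₂ : ∀ A ∈ V₂, ∀ w ∈ W₂, ∀ p : ℕ, p ≤ n - 1 → ∀ i j : Fin b,
      ((((A.map (C : ℂ → MvPolynomial (Fin 1) ℂ) + (X 0 : MvPolynomial (Fin 1) ℂ) • w.map C) ^ p :
        Matrix (Fin b) (Fin b) (MvPolynomial (Fin 1) ℂ)) i j).totalDegree ≤ k₂)) :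
    ∀ A ∈ V₁ ⊔ V₂, ∀ w ∈ W₁ ⊔ W₂, ∀ p : ℕ, p ≤ n - 1 → ∀ i j : Fin b,
      ((((A.map (C : ℂ → MvPolynomial (Fin 1) ℂ) + (X 0 : MvPolynomial (Fin 1) ℂ) • w.map C) ^ p :
        Matrix (Fin b) (Fin b) (MvPolynomial (Fin 1) ℂ)) i j).totalDegree ≤ k₁ + k₂) := by
  intro A hA w hw p hp i j
  obtain ⟨A₁, hA₁, A₂, hA₂, rfl⟩ := Submodule.mem_sup.mp hA
  obtain ⟨w₁, hw₁, w₂, hw₂, rfl⟩ := Submodule.mem_sup.mp hw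
  rw [lineMat_add]
  -- the two line matrices commute
  have hc : Commute (A₁.map (C : ℂ → MvPolynomial (Fin 1) ℂ) + (X 0 : MvPolynomial (Fin 1) ℂ) • w₁.map C)
      (A₂.map (C : ℂ → MvPolynomial (Fin 1) ℂ) + (X 0 : MvPolynomial (Fin 1) ℂ) • w₂.map C) := by
    refine Commute.add_left (Commute.add_right ?_ ?_) (Commute.add_right ?_ ?_)
    · exact commute_map_C (hcomm A₁ hA₁ A₂ hA₂)
    · exact (commute_map_C (hcomm A₁ hA₁ w₂ (hW₂ hw₂))).smul_right _
    · exact (commute_map_C (hcomm w₁ (hW₁ hw₁) A₂ hA₂)).smul_left _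
    · exact ((commute_map_C (hcomm w₁ (hW₁ hw₁) w₂ (hW₂ hw₂))).smul_left _).smul_right _
  refine totalDegree_add_pow_apply_le_of_commute hc (fun a ha i' j' => ?_) (fun a ha i' j' => ?_) i j
  · exact h₁ A₁ hA₁ w₁ hw₁ a (by omega) i' j'
  · exact h₂ A₂ hA₂ w₂ hw₂ a (by omega) i' j'

/-- Codimensions are sub-additive over `⊔`. -/
theorem codim_sup_le (V₁ V₂ W₁ W₂ : Submodule ℂ (Matrix (Fin b) (Fin b) ℂ)) (hW₁ : W₁ ≤ V₁) (hW₂ : W₂ ≤ V₂) :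
    Module.finrank ℂ ↥(V₁ ⊔ V₂) - Module.finrank ℂ ↥(W₁ ⊔ W₂) ≤
      (Module.finrank ℂ V₁ - Module.finrank ℂ W₁) + (Module.finrank ℂ V₂ - Module.finrank ℂ W₂) := by
  have hV := Submodule.finrank_sup_add_finrank_inf_eq V₁ V₂
  have hW := Submodule.finrank_sup_add_finrank_inf_eq W₁ W₂
  have hinf : Module.finrank ℂ ↥(W₁ ⊓ W₂) ≤ Module.finrank ℂ ↥(V₁ ⊓ V₂) := Submodule.finrank_mono (inf_le_inf hW₁ hW₂)
  have h1 : Module.finrank ℂ W₁ ≤ Module.finrank ℂ V₁ := Submodule.finrank_mono hW₁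
  have h2 : Module.finrank ℂ W₂ ≤ Module.finrank ℂ V₂ := Submodule.finrank_mono hW₂
  omega

/-- ★★★ **THE (c)-PRICE IS SUB-ADDITIVE OVER COMMUTING SUMS** (submodule currency of ✓ `longMassSlowLawInv_iff_submodule`): certificates of
prices `P₁`, `P₂` for commuting `V₁`, `V₂` give a certificate of price `≤ P₁ + P₂` for `V₁ ⊔ V₂`. -/
theorem price_sup_of_commute (V₁ V₂ : Submodule ℂ (Matrix (Fin b) (Fin b) ℂ))
    (hcomm : ∀ A₁ ∈ V₁, ∀ A₂ ∈ V₂, A₁ * A₂ = A₂ * A₁) {n P₁ P₂ : ℕ}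
    (h₁ : ∃ (W : Submodule ℂ (Matrix (Fin b) (Fin b) ℂ)) (k : ℕ), W ≤ V₁ ∧
      (∀ A ∈ V₁, ∀ w ∈ W, ∀ p : ℕ, p ≤ n - 1 → ∀ i j : Fin b,
        ((((A.map (C : ℂ → MvPolynomial (Fin 1) ℂ) + (X 0 : MvPolynomial (Fin 1) ℂ) • w.map C) ^ p :
          Matrix (Fin b) (Fin b) (MvPolynomial (Fin 1) ℂ)) i j).totalDegree ≤ k)) ∧
      n * k + (Module.finrank ℂ V₁ - Module.finrank ℂ W) ≤ P₁)
    (h₂ : ∃ (W : Submodule ℂ (Matrix (Fin b) (Fin b) ℂ)) (k : ℕ), W ≤ V₂ ∧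
      (∀ A ∈ V₂, ∀ w ∈ W, ∀ p : ℕ, p ≤ n - 1 → ∀ i j : Fin b,
        ((((A.map (C : ℂ → MvPolynomial (Fin 1) ℂ) + (X 0 : MvPolynomial (Fin 1) ℂ) • w.map C) ^ p :
          Matrix (Fin b) (Fin b) (MvPolynomial (Fin 1) ℂ)) i j).totalDegree ≤ k)) ∧
      n * k + (Module.finrank ℂ V₂ - Module.finrank ℂ W) ≤ P₂) :
    ∃ (W : Submodule ℂ (Matrix (Fin b) (Fin b) ℂ)) (k : ℕ), W ≤ V₁ ⊔ V₂ ∧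
      (∀ A ∈ V₁ ⊔ V₂, ∀ w ∈ W, ∀ p : ℕ, p ≤ n - 1 → ∀ i j : Fin b,
        ((((A.map (C : ℂ → MvPolynomial (Fin 1) ℂ) + (X 0 : MvPolynomial (Fin 1) ℂ) • w.map C) ^ p :
          Matrix (Fin b) (Fin b) (MvPolynomial (Fin 1) ℂ)) i j).totalDegree ≤ k)) ∧
      n * k + (Module.finrank ℂ ↥(V₁ ⊔ V₂) - Module.finrank ℂ W) ≤ P₁ + P₂ := by
  obtain ⟨W₁, k₁, hW₁, hwin₁, hprice₁⟩ := h₁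
  obtain ⟨W₂, k₂, hW₂, hwin₂, hprice₂⟩ := h₂
  refine ⟨W₁ ⊔ W₂, k₁ + k₂, sup_le_sup hW₁ hW₂, window_sup_of_commute V₁ V₂ W₁ W₂ hW₁ hW₂ hcomm hwin₁ hwin₂, ?_⟩
  have hcod := codim_sup_le V₁ V₂ W₁ W₂ hW₁ hW₂
  have : n * (k₁ + k₂) = n * k₁ + n * k₂ := by ring
  omega

end Summit.ValiantsHypothesis.ValiantsHypothesis.Theorems.GrenetZeon.LongMassHomogenise

end
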